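import Literature.NumberTheory.NumberFields.RayClassFieldAdicArtinValue
import HarnessLib

/-!
# The `v`-adic Artin character of the ray class tower `K(𝔪vⁿ)`: `κ : Gal(K̄/K(𝔪)) →* 𝒪_vˣ` with
# `[⟨κσ⟩_v, K] = σ` on every `K(𝔪vⁿ)`, cutting out `Gal(K̄/K(𝔪vⁿ))` by `κ ≡ 1 mod vⁿ`, ONTO `𝒪_vˣ`
# (de Shalit 1987, II.1.7–1.9 / I.3.3 (9), by class field theory; part 2 of 3)

Sequel of `RayClassFieldAdicArtinValue.lean` (existence and uniqueness of `v`-adic Artin values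
`σ|_{K(𝔪vⁿ)} = [⟨u⟩_v, K]|_{K(𝔪vⁿ)}`). De Shalit II.1.7–1.9 / I.3.3 (9): for `K` imaginary quadratic,
`w_𝔣 = 1`, `𝔭 ∤ 𝔣`, `Gal(K(𝔣𝔭^∞)/K(𝔣)) ≅ 𝒪_𝔭ˣ`, the layer `K(𝔣𝔭ⁿ)` cut out by `1 + 𝔭ⁿ𝒪_𝔭` — the
`κ : G ≃ ℤ_p^×` along which the measures of II.4 are pulled back to the Galois group. THIS FILE, for
any totally complex number field `K`, `𝔪 ≠ 0` with `w_𝔪 = 1`, `v ∤ 𝔪`: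

* §3a change of modulus: `IsAdicArtinValue.of_le` (a value above `𝔪' ⊆ 𝔪` is a value above `𝔪`),
  `ker_absRestrictNormalHom_rayClassField_anti` (`Gal(K̄/K(𝔪')) ≤ Gal(K̄/K(𝔪))`).
* §3 ★ `rayAdicCharacter h𝔪 hv hw : Gal(K̄/K(𝔪)) →* 𝒪_vˣ` (THE value; a group homomorphism by
  uniqueness), `absRestrictNormalHom_eq_of_rayAdicCharacter` (the Artin characterisation
  `σ|_{K(𝔪vⁿ)} = [⟨κσ⟩_v, K]|_{K(𝔪vⁿ)}`), ★★ `mem_ker_rayClassField_mul_pow_iff_valued` — **`hU`**: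
  `σ ∈ Gal(K̄/K(𝔪vⁿ)) ↔ |κσ − 1|_v ≤ |vⁿ|` — ★★ `rayAdicCharacter_surjective` — **de Shalit's (9):
  `κ` is ONTO `𝒪_vˣ`** (so `Gal(K(𝔪vⁿ)/K(𝔪)) ≅ 𝒪_vˣ/(1 + vⁿ𝒪_v)`; at a split `v ∣ 2` this is
  `(ℤ/2ⁿ)ˣ`, cyclic only above level `2` — the `1 + 4ℤ₂` of II.4.17) — and
  `rayAdicCharacter_eq_of_le`: for `𝔪 ∣ 𝔪'` the characters above `𝔪'` and `𝔪` agree on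
  `Gal(K̄/K(𝔪'))`, so ONE character on `Gal(K̄/K(𝔪))` serves every tower `K(𝔪'vⁿ)` (the common group
  of de Shalit's double tower `K(𝔤𝔭̄^m𝔭^n)`, II.4.14 Step 1).

The `ℤ_p`-reading (`hU`/`hκ` of `ProfiniteGroupDistributionCharacterCells.lean` VERBATIM) and the
packaged `SubgroupTower`s are in part 3, `RayClassFieldAdicCharacterTower.lean`.

Sign convention: the tree's `[·, K]` sends a prime element to the Frobenius, so de Shalit's `κ`
(action on `𝔭^∞`-torsion, `σ_𝔞 ↦ φ(𝔞)`) is `κ⁻¹` of this file; `hU` and surjectivity are insensitive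
to the inversion. `p = 2` note: for `K = ℚ(√−7)` the hypothesis `w_𝔪 = 1` reads `𝔪 ∤ 2` (`−1 ≡ 1`
exactly modulo the divisors of `2`), so `𝔪 = 𝔭̄` is excluded and `𝔪 = 𝔭̄²`, `𝔤𝔭̄` are fine — de
Shalit's `𝔣 = 𝔤𝔭̄^m`, `m ≥ 1` large. One definition with body (`rayAdicCharacter`); theorems otherwise;
no named facts, no instances, no `sorry`.

## References

* [deShalit1987] E. de Shalit, *Iwasawa theory of elliptic curves with complex multiplication*
  (1987), I.3.3 (9) (p. 17–18), II.1.7–1.9 (p. 41–43), II.4.6 (p. 59), II.4.12 Remark (i) (p. 67),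
  II.4.14 Step 1 (p. 71), II.4.17 (p. 77–78).
* [NeukirchANT1999] J. Neukirch, *Algebraic Number Theory* (1999), Ch. IV §1 (1.1), Ch. VI §6 (6.2),
  §7 (7.1).
-/

noncomputable section

open NumberField IsDedekindDomain IsDedekindDomain.HeightOneSpectrum Field
open scoped nonZeroDivisors Classical

namespace Literature.NumberTheory.NumberFields

open Literature.NumberTheory.GaloisRepresentations

variable {K : Type} [Field K] [NumberField K]

/-! ### §3a. Change of modulus: a value above `𝔪' ⊆ 𝔪` is a value above `𝔪` -/

section Modulus

omit [NumberField K] in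
/-- Whatever restricts trivially to `L'` restricts trivially to `L ≤ L'`. [cite: NeukirchANT1999, Ch. IV §1 Thm. (1.1)] -/
theorem ker_absRestrictNormalHom_anti_of_le {L L' : IntermediateField K (AlgebraicClosure K)}
    [Normal K L] [Normal K L'] (h : L ≤ L') :
    (absRestrictNormalHom L').ker ≤ (absRestrictNormalHom L).ker := by
  intro γ hγ
  rw [MonoidHom.mem_ker, absRestrictNormalHom_eq_one_iff, IntermediateField.mem_fixingSubgroup_iff] at hγ ⊢
  exact fun x hx ↦ hγ x (h hx)

omit [NumberField K] in
/-- Restrictions to `L ≤ L'` agree as soon as restrictions to `L'` agree. [cite: NeukirchANT1999, Ch. IV §1 Thm. (1.1)] -/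
theorem absRestrictNormalHom_eq_of_le {L L' : IntermediateField K (AlgebraicClosure K)}
    [Normal K L] [Normal K L'] (h : L ≤ L') {σ τ : absoluteGaloisGroup K}
    (hστ : absRestrictNormalHom L' σ = absRestrictNormalHom L' τ) :
    absRestrictNormalHom L σ = absRestrictNormalHom L τ := by
  rw [← inv_mul_eq_one, ← map_inv, ← map_mul, ← MonoidHom.mem_ker] at hστ ⊢
  exact ker_absRestrictNormalHom_anti_of_le h hστ

variable {𝔪 𝔪' : Ideal (𝓞 K)} {v : HeightOneSpectrum (𝓞 K)}

/-- `Gal(K̄/K(𝔪')) ≤ Gal(K̄/K(𝔪))` for `0 ≠ 𝔪' ⊆ 𝔪` (`K(𝔪) ⊆ K(𝔪')`).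
[cite: NeukirchANT1999, Ch. VI §6 Def. (6.2)] -/
theorem ker_absRestrictNormalHom_rayClassField_anti (h𝔪' : 𝔪' ≠ ⊥) (hle : 𝔪' ≤ 𝔪) :
    (absRestrictNormalHom (rayClassField K 𝔪')).ker ≤ (absRestrictNormalHom (rayClassField K 𝔪)).ker :=
  ker_absRestrictNormalHom_anti_of_le (rayClassField_le_of_le h𝔪' hle)

/-- **Change of modulus**: for `0 ≠ 𝔪' ⊆ 𝔪`, a `v`-adic Artin value of `σ` above `𝔪'` is one above
`𝔪` (every layer `K(𝔪vⁿ) ⊆ K(𝔪'vⁿ)`). [cite: deShalit1987, II.4.12 Remark (i) (p. 67)]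
[cite: NeukirchANT1999, Ch. VI §6 Def. (6.2)] -/
theorem IsAdicArtinValue.of_le (h𝔪' : 𝔪' ≠ ⊥) (hle : 𝔪' ≤ 𝔪) {σ : absoluteGaloisGroup K}
    {u : (v.adicCompletionIntegers K)ˣ} (h : IsAdicArtinValue 𝔪' v σ u) : IsAdicArtinValue 𝔪 v σ u := by
  intro n
  obtain ⟨τ, hτ⟩ := QuotientGroup.mk'_surjective (commutator (absoluteGaloisGroup K)).topologicalClosure
    (ideleArtinMap K (localUnits v (Units.map ((v.adicCompletionIntegers K).subtype : _ →* _) u)))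
  have hτ' : ∀ L : IntermediateField K (AlgebraicClosure K), ∀ (_ : FiniteDimensional K L)
      (_ : IsAbelianGalois K L), absRestrictNormalHom L τ = abRestrict L (ideleArtinMap K
        (localUnits v (Units.map ((v.adicCompletionIntegers K).subtype : _ →* _) u))) := by
    intro L _ _
    rw [← abRestrict_absGaloisAbProj]
    exact congrArg (abRestrict L) hτ
  rw [← hτ' (rayClassField K (𝔪 * v.asIdeal ^ n)) inferInstance inferInstance]
  refine absRestrictNormalHom_eq_of_le (rayClassField_le_of_le
    (mul_ne_zero h𝔪' (pow_ne_zero _ v.ne_bot)) (Ideal.mul_mono_left hle)) ?_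
  rw [h n, hτ' (rayClassField K (𝔪' * v.asIdeal ^ n)) inferInstance inferInstance]

omit [NumberField K] in
/-- `w_𝔪 = 1` descends to every `𝔪' ⊆ 𝔪`. [cite: deShalit1987, II.1.7 (p. 41)] -/
theorem units_eq_one_of_sub_one_mem_of_le (hle : 𝔪' ≤ 𝔪)
    (hw : ∀ u : (𝓞 K)ˣ, (u : 𝓞 K) - 1 ∈ 𝔪 → u = 1) (u : (𝓞 K)ˣ) (hu : (u : 𝓞 K) - 1 ∈ 𝔪') : u = 1 :=
  hw u (hle hu)

end Modulus

/-! ### §3. The character `κ : Gal(K̄/K(𝔪)) →* 𝒪_vˣ`: Artin characterisation, `hU`, surjectivity -/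

section Character

variable [IsTotallyComplex K] {𝔪 : Ideal (𝓞 K)} {v : HeightOneSpectrum (𝓞 K)}
  (h𝔪 : 𝔪 ≠ ⊥) (hv : ¬ 𝔪 ≤ v.asIdeal) (hw : ∀ u : (𝓞 K)ˣ, (u : 𝓞 K) - 1 ∈ 𝔪 → u = 1)

/-- ★ **The `v`-adic Artin character `κ : Gal(K̄/K(𝔪)) →* 𝒪_vˣ` of the ray class tower `K(𝔪vⁿ)`**
(`K` totally complex, `𝔪 ≠ 0`, `v ∤ 𝔪`, `w_𝔪 = 1`): `κσ` is THE local unit with `σ = [⟨κσ⟩_v, K]` on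
every `K(𝔪vⁿ)` (existence `exists_isAdicArtinValue`, uniqueness `IsAdicArtinValue.unique`); a group
homomorphism by uniqueness. De Shalit's `κ : Gal(K(𝔣𝔭^∞)/K(𝔣)) ≃ 𝒪_𝔭ˣ` (II.1.7, I.3.3 (9)) is this
map up to the sign convention of the reciprocity map (the tree's `[·, K]` sends a prime element to the
Frobenius, so de Shalit's `κ`, which records the action on `𝔭^∞`-torsion, is `κ⁻¹` of this file).
[cite: deShalit1987, I.3.3 (9) (p. 18), II.1.7 (p. 41)] [cite: NeukirchANT1999, Ch. VI §7 Thm. (7.1)] -/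
def rayAdicCharacter (h𝔪 : 𝔪 ≠ ⊥) (hv : ¬ 𝔪 ≤ v.asIdeal)
    (hw : ∀ u : (𝓞 K)ˣ, (u : 𝓞 K) - 1 ∈ 𝔪 → u = 1) :
    ↥(absRestrictNormalHom (rayClassField K 𝔪)).ker →* (v.adicCompletionIntegers K)ˣ where
  toFun σ := Classical.choose (exists_isAdicArtinValue (v := v) h𝔪 σ.2)
  map_one' :=
    IsAdicArtinValue.unique h𝔪 hv hw
      (Classical.choose_spec (exists_isAdicArtinValue (v := v) h𝔪 (1 : ↥(absRestrictNormalHom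
        (rayClassField K 𝔪)).ker).2)) IsAdicArtinValue.one
  map_mul' σ τ :=
    IsAdicArtinValue.unique h𝔪 hv hw
      (Classical.choose_spec (exists_isAdicArtinValue (v := v) h𝔪 (σ * τ).2))
      ((Classical.choose_spec (exists_isAdicArtinValue (v := v) h𝔪 σ.2)).mul
        (Classical.choose_spec (exists_isAdicArtinValue (v := v) h𝔪 τ.2)))

/-- `κσ` IS a `v`-adic Artin value of `σ`. [cite: deShalit1987, I.3.3 (9) (p. 18)] -/
theorem isAdicArtinValue_rayAdicCharacter (σ : ↥(absRestrictNormalHom (rayClassField K 𝔪)).ker) :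
    IsAdicArtinValue 𝔪 v (σ : absoluteGaloisGroup K) (rayAdicCharacter h𝔪 hv hw σ) :=
  Classical.choose_spec (exists_isAdicArtinValue (v := v) h𝔪 σ.2)

/-- **Characterisation**: any `v`-adic Artin value of `σ` is `κσ`. [cite: deShalit1987, I.3.3 (9) (p. 18)] -/
theorem rayAdicCharacter_eq_of_isAdicArtinValue {σ : ↥(absRestrictNormalHom (rayClassField K 𝔪)).ker}
    {u : (v.adicCompletionIntegers K)ˣ} (h : IsAdicArtinValue 𝔪 v (σ : absoluteGaloisGroup K) u) :
    rayAdicCharacter h𝔪 hv hw σ = u :=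
  IsAdicArtinValue.unique h𝔪 hv hw (isAdicArtinValue_rayAdicCharacter h𝔪 hv hw σ) h

/-- **The Artin property, spelled out**: `σ|_{K(𝔪vⁿ)} = [⟨κσ⟩_v, K]|_{K(𝔪vⁿ)}` for every `n`.
[cite: NeukirchANT1999, Ch. VI §7 Thm. (7.1)] [cite: deShalit1987, II.1.7 (p. 41)] -/
theorem absRestrictNormalHom_eq_of_rayAdicCharacter (σ : ↥(absRestrictNormalHom (rayClassField K 𝔪)).ker)
    (n : ℕ) :
    absRestrictNormalHom (rayClassField K (𝔪 * v.asIdeal ^ n)) (σ : absoluteGaloisGroup K) =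
      abRestrict (rayClassField K (𝔪 * v.asIdeal ^ n)) (ideleArtinMap K (localUnits v
        (Units.map ((v.adicCompletionIntegers K).subtype : _ →* _) (rayAdicCharacter h𝔪 hv hw σ)))) :=
  isAdicArtinValue_rayAdicCharacter h𝔪 hv hw σ n

/-- ★★ **`hU` — the character cuts out the tower**: for `σ ∈ Gal(K̄/K(𝔪))`,
`σ ∈ Gal(K̄/K(𝔪vⁿ)) ↔ κσ ≡ 1 mod vⁿ` (`|κσ − 1|_v ≤ |vⁿ|_v`) — de Shalit II.1.9:
`Gal(K(𝔣𝔭ⁿ)/K(𝔣))` corresponds to the principal units of level `n`; the hypothesis `hU` of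
`SubgroupTower.cellMap_injective` / `exists_cellMap_of_character` for the tower
`U_n = Gal(K̄/K(𝔪v^{n+1}))` (read in `ℤ_p`: §4). [cite: deShalit1987, II.1.9 (p. 43), II.4.6 (p. 59)]
[cite: NeukirchANT1999, Ch. VI §7 Thm. (7.1)] -/
theorem mem_ker_rayClassField_mul_pow_iff_valued (σ : ↥(absRestrictNormalHom (rayClassField K 𝔪)).ker)
    (n : ℕ) :
    (σ : absoluteGaloisGroup K) ∈ (absRestrictNormalHom (rayClassField K (𝔪 * v.asIdeal ^ n))).ker ↔
      Valued.v ((((rayAdicCharacter h𝔪 hv hw σ : (v.adicCompletionIntegers K)ˣ) :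
        v.adicCompletionIntegers K) : v.adicCompletion K) - 1) ≤ WithZero.exp (-(n : ℤ)) := by
  rw [(isAdicArtinValue_rayAdicCharacter h𝔪 hv hw σ).mem_ker_iff_mem_sup,
    localUnits_integer_mem_sup_rayUnitIdeles_mul_pow_iff h𝔪 hv hw,
    localUnits_integer_mem_rayUnitIdeles_mul_pow_iff h𝔪 hv]

/-- ★★ **de Shalit's (9): `κ` is ONTO `𝒪_vˣ`** — every local unit `u` is `κσ` for some
`σ ∈ Gal(K̄/K(𝔪))`: lift `[⟨u⟩_v, K] ∈ Γ_K^ab` to `Γ_K`; it fixes `K(𝔪)` because `⟨u⟩_v ∈ W_𝔪`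
(`v ∤ 𝔪`), and `u` is its value at every level. Hence `Gal(K(𝔪vⁿ)/K(𝔪)) ≅ 𝒪_vˣ/(1 + vⁿ𝒪_v)`
(with `hU`), the strong form of the consumer's `hκ`
(`SubgroupTower.exists_toZModPow_character_eq_of_forall_exists_eq`).
[cite: deShalit1987, I.3.3 (9) (p. 18), II.1.7 (p. 41)] [cite: NeukirchANT1999, Ch. VI §7 Thm. (7.1)] -/
theorem rayAdicCharacter_surjective : Function.Surjective (rayAdicCharacter h𝔪 hv hw) := by
  intro u
  set c := localUnits v (Units.map ((v.adicCompletionIntegers K).subtype : _ →* _) u) with hc_def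
  obtain ⟨σ, hσ⟩ := QuotientGroup.mk'_surjective (commutator (absoluteGaloisGroup K)).topologicalClosure
    (ideleArtinMap K c)
  have hσ' : ∀ L : IntermediateField K (AlgebraicClosure K), ∀ (_ : FiniteDimensional K L)
      (_ : IsAbelianGalois K L), absRestrictNormalHom L σ = abRestrict L (ideleArtinMap K c) := by
    intro L _ _
    rw [← abRestrict_absGaloisAbProj]
    exact congrArg (abRestrict L) hσ
  have hmem : σ ∈ (absRestrictNormalHom (rayClassField K 𝔪)).ker := by
    rw [MonoidHom.mem_ker, hσ' (rayClassField K 𝔪) inferInstance inferInstance, hc_def,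
      abRestrict_ideleArtinMap_rayClassField_localUnits_integer h𝔪 hv u]
  exact ⟨⟨σ, hmem⟩, rayAdicCharacter_eq_of_isAdicArtinValue h𝔪 hv hw
    fun n ↦ hσ' (rayClassField K (𝔪 * v.asIdeal ^ n)) inferInstance inferInstance⟩

/-- **Levelwise reading of `hU` + surjectivity**: every class `u mod vⁿ` of local units is the class
of `κσ` for some `σ ∈ Gal(K̄/K(𝔪))` — `Gal(K(𝔪vⁿ)/K(𝔪)) ≅ 𝒪_vˣ/(1 + vⁿ𝒪_v)` is onto.
[cite: deShalit1987, II.1.9 (p. 43)] -/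
theorem exists_valued_rayAdicCharacter_div_sub_one_le (n : ℕ) (u : (v.adicCompletionIntegers K)ˣ) :
    ∃ σ : ↥(absRestrictNormalHom (rayClassField K 𝔪)).ker,
      Valued.v ((((rayAdicCharacter h𝔪 hv hw σ * u⁻¹ : (v.adicCompletionIntegers K)ˣ) :
        v.adicCompletionIntegers K) : v.adicCompletion K) - 1) ≤ WithZero.exp (-(n : ℤ)) := by
  obtain ⟨σ, hσ⟩ := rayAdicCharacter_surjective h𝔪 hv hw u
  refine ⟨σ, ?_⟩
  rw [hσ, mul_inv_cancel, Units.val_one, OneMemClass.coe_one, sub_self, map_zero]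
  exact zero_le

/-- **Compatibility under change of modulus**: for `0 ≠ 𝔪' ⊆ 𝔪` (`v ∤ 𝔪`, hence `v ∤ 𝔪'`; `w_𝔪 = 1`,
hence `w_{𝔪'} = 1`) and `σ ∈ Gal(K̄/K(𝔪')) ≤ Gal(K̄/K(𝔪))`, the characters above `𝔪'` and above `𝔪`
agree on `σ` — ONE character on `Gal(K̄/K(𝔪))` serves all the towers `K(𝔪'vⁿ)`, `𝔪 ∣ 𝔪'` (the common
group of de Shalit's double tower `K(𝔤𝔭̄^m𝔭^n)`, II.4.14 Step 1). [cite: deShalit1987, II.4.12 Remark (i) (p. 67), II.4.14 Step 1 (p. 71)] -/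
theorem rayAdicCharacter_eq_of_le {𝔪' : Ideal (𝓞 K)} (h𝔪' : 𝔪' ≠ ⊥) (hle : 𝔪' ≤ 𝔪)
    (hv' : ¬ 𝔪' ≤ v.asIdeal) (hw' : ∀ u : (𝓞 K)ˣ, (u : 𝓞 K) - 1 ∈ 𝔪' → u = 1)
    (σ : ↥(absRestrictNormalHom (rayClassField K 𝔪')).ker) :
    rayAdicCharacter h𝔪 hv hw ⟨σ, ker_absRestrictNormalHom_rayClassField_anti h𝔪' hle σ.2⟩ =
      rayAdicCharacter h𝔪' hv' hw' σ :=
  rayAdicCharacter_eq_of_isAdicArtinValue h𝔪 hv hw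
    ((isAdicArtinValue_rayAdicCharacter h𝔪' hv' hw' σ).of_le h𝔪' hle)

end Character

end Literature.NumberTheory.NumberFields

end
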